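import Summits.CriticalPhenomena.PercolationContinuityZ3.Theorems.PercNearOneGluingNoHeavyLowerTailKnQuestion8CoefficientwiseCoreClassKernelMixPathTransfer
import HarnessLib

/-!
# The regime reduction of the increasing-event transfer (any graph, any up-set)

Support file (`--supports stmt-CriticalPhenomena-4575`, closed), prover `prim-cplus-coupling` (gen 39).  No definitions, no notations, no named facts,
no sorries; standard axioms.  Memo `prim-cplus-coupling/A5-COUPLING-gen39.md` §4.2.

CONJECTURE IET (gen 37 memo §2): for a finite multigraph (`ends`, edge set `E`), root `u`, observer `b`, EVERY up-closed event `𝒱` on the colourings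
`ω ⊆ E`, all monotone `h, k` and monotone levels `0 ≤ hᵃ, hᵇ ≤ h`, `0 ≤ kᵃ, kᵇ ≤ k`:
  `IET(h,k) := Σ_{ω ∈ 𝒱 : b ∈ X∖Y} h(X)k(X) + Σ_{ω ∈ 𝒱 : b ∈ Y∖X} (hᵃX − hᵇY)(kᵃX − kᵇY) ≥ 0`,  `X = C_u ω`, `Y = C_u(E∖ω)`.
THE REGIME SPLIT.  Put `α₀ = hᵃ{u}`, `γ₀ = kᵃ{u}`; every cluster contains `u`, so `hᵃ, h ≥ α₀` and `kᵃ, k ≥ γ₀` on all sets in sight.  Writing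
`hᵃX = α₀ + a₂`, `hᵇY = min(hᵇY, α₀) + (hᵇY − α₀)⁺` (and likewise on the `k` side) splits each anti-term into four products; the `00` product is `≥ 0`, the
two mixed products cost at most `α₀ (kᵇY − γ₀)⁺ + γ₀ (hᵇY − α₀)⁺`, which ONE Harris inequality each moves onto `{b ∈ X∖Y} ∩ 𝒱` (the function
`ω ↦ 1_𝒱` is increasing and `ω ↦ (kᵇ(Yω) − γ₀)⁺ 1[b ∈ Yω∖Xω]` is decreasing with complement-conjugate `(kᵇ(Xω) − γ₀)⁺ 1[b ∈ Xω∖Yω]`), where the supply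
`hk = α₀γ₀ + α₀(k − γ₀) + γ₀(h − α₀) + (h − α₀)(k − γ₀)` has exactly these budgets to spare.  What is left is IET for the REDUCED level system
`h₂ = h − α₀`, `hᵃ₂ = hᵃ − α₀`, `hᵇ₂ = (hᵇ − α₀)⁺`, `k₂, kᵃ₂, kᵇ₂` (again admissible on the sets containing `u`), which VANISHES ON `{u}` on the `a`-side.
* `Coefficientwise.regime_pointwise` — the pointwise split of one anti-term.
* `Coefficientwise.iet_regime_reduction` — **`IET(h, k) ≥ IET(h₂, k₂)`** on every graph, for every up-set (the reduced levels are written with `insert u ·` so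
  that they are admissible on all sets).
* `Coefficientwise.iet_of_iet_vanishing_base` — hence CONJECTURE IET is equivalent to its special case `hᵃ{u} = kᵃ{u} = 0` (in which the demand points with
  `X = {u}` contribute `hᵇ₂kᵇ₂ ≥ 0`).  The cycle case of the conjecture is settled in memo §3 (fibre lemmas `…KernelMixFibreInjection`).
[cite: KozmaNitzan2024, Questions 8–9 (§5.5 p. 36) (context: the Question-8 pocket covariance programme)]
-/

namespace Summit.CriticalPhenomena.PercolationContinuityZ3.Theorems

open Finset Literature.Probability.Percolation

namespace Coefficientwise

variable {ι V : Type*}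

/-- The pointwise regime split of one anti-term: for `0 ≤ α₀ ≤ a`, `0 ≤ p`, `0 ≤ γ₀ ≤ c`, `0 ≤ q`,
`(a − p)(c − q) ≥ (a − α₀ − (p − α₀)⁺)(c − γ₀ − (q − γ₀)⁺) − α₀ (q − γ₀)⁺ − γ₀ (p − α₀)⁺`.
[cite: KozmaNitzan2024, §5.5 (context only; elementary)] -/
theorem regime_pointwise {α₀ γ₀ a p c q : ℝ} (hα : 0 ≤ α₀) (hγ : 0 ≤ γ₀) (hαa : α₀ ≤ a) (hp : 0 ≤ p) (hγc : γ₀ ≤ c) (hq : 0 ≤ q) :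
    (a - α₀ - max (p - α₀) 0) * (c - γ₀ - max (q - γ₀) 0) - α₀ * max (q - γ₀) 0 - γ₀ * max (p - α₀) 0 ≤ (a - p) * (c - q) := by
  rcases le_or_gt p α₀ with hp' | hp' <;> rcases le_or_gt q γ₀ with hq' | hq'
  · rw [max_eq_right (by linarith : p - α₀ ≤ 0), max_eq_right (by linarith : q - γ₀ ≤ 0)]
    nlinarith [mul_nonneg (sub_nonneg.mpr hp') (sub_nonneg.mpr (le_trans hq' hγc)), mul_nonneg (sub_nonneg.mpr hαa) (sub_nonneg.mpr hq')]
  · rw [max_eq_right (by linarith : p - α₀ ≤ 0), max_eq_left (by linarith : 0 ≤ q - γ₀)]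
    nlinarith [mul_nonneg (sub_nonneg.mpr hp') (sub_nonneg.mpr hγc), mul_nonneg hp (sub_nonneg.mpr hq'.le)]
  · rw [max_eq_left (by linarith : 0 ≤ p - α₀), max_eq_right (by linarith : q - γ₀ ≤ 0)]
    nlinarith [mul_nonneg (sub_nonneg.mpr hq') (sub_nonneg.mpr hαa), mul_nonneg hq (sub_nonneg.mpr hp'.le)]
  · rw [max_eq_left (by linarith : 0 ≤ p - α₀), max_eq_left (by linarith : 0 ≤ q - γ₀)]
    nlinarith

open Classical in
/-- **REGIME REDUCTION (any graph, any up-set).**  With `α₀ = hᵃ{u}`, `γ₀ = kᵃ{u}` and the reduced levels `h₂ = h(insert u ·) − α₀`,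
`hᵃ₂ = hᵃ(insert u ·) − α₀`, `hᵇ₂ = (hᵇ(insert u ·) − α₀)⁺`, `k₂ = k(insert u ·) − γ₀`, `kᵃ₂ = kᵃ(insert u ·) − γ₀`, `kᵇ₂ = (kᵇ(insert u ·) − γ₀)⁺`
(on the clusters of `u` the `insert u` is void):  `IET(h₂, k₂; 𝒱) ≤ IET(h, k; 𝒱)`.  Proof: `regime_pointwise` at every demand point, the splitting
`hk = α₀γ₀ + α₀(k−γ₀) + γ₀(h−α₀) + (h−α₀)(k−γ₀)` at every supply point, and two Harris inequalities (`sum_mul_sdiff_le_sum_mul`) moving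
`(kᵇY − γ₀)⁺`, `(hᵇY − α₀)⁺` from `𝒱 ∩ {b ∈ Y∖X}` to `𝒱 ∩ {b ∈ X∖Y}`. [cite: KozmaNitzan2024, Questions 8–9 (§5.5 p. 36) (context)] -/
theorem iet_regime_reduction (ends : ι → Sym2 V) (E : Finset ι) (u b : V)
    (𝒱 : Finset ι → Prop) (hV : ∀ ⦃s t : Finset ι⦄, s ⊆ t → 𝒱 s → 𝒱 t)
    (h k ha hb ka kb : Set V → ℝ)
    (mha : Monotone ha) (mhb : Monotone hb) (mka : Monotone ka) (mkb : Monotone kb)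
    (ha0 : ∀ X, 0 ≤ ha X) (hah : ∀ X, ha X ≤ h X) (hb0 : ∀ X, 0 ≤ hb X) (hbh : ∀ X, hb X ≤ h X)
    (ka0 : ∀ X, 0 ≤ ka X) (kak : ∀ X, ka X ≤ k X) (kb0 : ∀ X, 0 ≤ kb X) (kbk : ∀ X, kb X ≤ k X) :
    (∑ ω ∈ E.powerset, if 𝒱 ω ∧ b ∈ openCluster (ends '' (↑ω : Set ι)) u ∧ b ∉ openCluster (ends '' (↑(E \ ω) : Set ι)) u then
        (h (insert u (openCluster (ends '' (↑ω : Set ι)) u)) - ha {u}) * (k (insert u (openCluster (ends '' (↑ω : Set ι)) u)) - ka {u}) else 0)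
      + (∑ ω ∈ E.powerset, if 𝒱 ω ∧ b ∈ openCluster (ends '' (↑(E \ ω) : Set ι)) u ∧ b ∉ openCluster (ends '' (↑ω : Set ι)) u then
        (ha (insert u (openCluster (ends '' (↑ω : Set ι)) u)) - ha {u} - max (hb (insert u (openCluster (ends '' (↑(E \ ω) : Set ι)) u)) - ha {u}) 0) *
          (ka (insert u (openCluster (ends '' (↑ω : Set ι)) u)) - ka {u} - max (kb (insert u (openCluster (ends '' (↑(E \ ω) : Set ι)) u)) - ka {u}) 0)
        else 0)
    ≤ (∑ ω ∈ E.powerset, if 𝒱 ω ∧ b ∈ openCluster (ends '' (↑ω : Set ι)) u ∧ b ∉ openCluster (ends '' (↑(E \ ω) : Set ι)) u then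
        h (openCluster (ends '' (↑ω : Set ι)) u) * k (openCluster (ends '' (↑ω : Set ι)) u) else 0)
      + ∑ ω ∈ E.powerset, if 𝒱 ω ∧ b ∈ openCluster (ends '' (↑(E \ ω) : Set ι)) u ∧ b ∉ openCluster (ends '' (↑ω : Set ι)) u then
        (ha (openCluster (ends '' (↑ω : Set ι)) u) - hb (openCluster (ends '' (↑(E \ ω) : Set ι)) u)) *
          (ka (openCluster (ends '' (↑ω : Set ι)) u) - kb (openCluster (ends '' (↑(E \ ω) : Set ι)) u)) else 0 := by
  set C : Finset ι → Set V := fun ω => openCluster (ends '' (↑ω : Set ι)) u with hC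
  set α₀ : ℝ := ha {u} with hα₀
  set γ₀ : ℝ := ka {u} with hγ₀
  have huC : ∀ ω, u ∈ C ω := fun ω => mem_openCluster_self _ _
  have hins : ∀ ω, insert u (C ω) = C ω := fun ω => Set.insert_eq_of_mem (huC ω)
  have hsub : ∀ ω, ({u} : Set V) ⊆ C ω := fun ω => Set.singleton_subset_iff.mpr (huC ω)
  change (∑ ω ∈ E.powerset, if 𝒱 ω ∧ b ∈ C ω ∧ b ∉ C (E \ ω) then (h (insert u (C ω)) - α₀) * (k (insert u (C ω)) - γ₀) else 0)
      + (∑ ω ∈ E.powerset, if 𝒱 ω ∧ b ∈ C (E \ ω) ∧ b ∉ C ω then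
        (ha (insert u (C ω)) - α₀ - max (hb (insert u (C (E \ ω))) - α₀) 0) * (ka (insert u (C ω)) - γ₀ - max (kb (insert u (C (E \ ω))) - γ₀) 0) else 0)
    ≤ (∑ ω ∈ E.powerset, if 𝒱 ω ∧ b ∈ C ω ∧ b ∉ C (E \ ω) then h (C ω) * k (C ω) else 0)
      + ∑ ω ∈ E.powerset, if 𝒱 ω ∧ b ∈ C (E \ ω) ∧ b ∉ C ω then (ha (C ω) - hb (C (E \ ω))) * (ka (C ω) - kb (C (E \ ω))) else 0
  simp only [hins]
  have hα : 0 ≤ α₀ := ha0 {u}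
  have hγ : 0 ≤ γ₀ := ka0 {u}
  have hαa : ∀ ω, α₀ ≤ ha (C ω) := fun ω => mha (hsub ω)
  have hγc : ∀ ω, γ₀ ≤ ka (C ω) := fun ω => mka (hsub ω)
  have hαh : ∀ ω, α₀ ≤ h (C ω) := fun ω => le_trans (hαa ω) (hah _)
  have hγk : ∀ ω, γ₀ ≤ k (C ω) := fun ω => le_trans (hγc ω) (kak _)
  have hCmono : ∀ {ω ω' : Finset ι}, ω ⊆ ω' → C ω ⊆ C ω' := fun hle => openCluster_image_mono ends hle u
  -- (1) supply: h k ≥ (h−α₀)(k−γ₀) + α₀(k−γ₀) + γ₀(h−α₀)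
  have hsup : ∀ ω ∈ E.powerset,
      (if 𝒱 ω ∧ b ∈ C ω ∧ b ∉ C (E \ ω) then (h (C ω) - α₀) * (k (C ω) - γ₀) else 0)
        + (if 𝒱 ω ∧ b ∈ C ω ∧ b ∉ C (E \ ω) then α₀ * (k (C ω) - γ₀) else 0)
        + (if 𝒱 ω ∧ b ∈ C ω ∧ b ∉ C (E \ ω) then γ₀ * (h (C ω) - α₀) else 0)
      ≤ (if 𝒱 ω ∧ b ∈ C ω ∧ b ∉ C (E \ ω) then h (C ω) * k (C ω) else 0) := by
    intro ω _
    by_cases hc : 𝒱 ω ∧ b ∈ C ω ∧ b ∉ C (E \ ω)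
    · simp only [if_pos hc]; nlinarith [mul_nonneg hα hγ]
    · simp only [if_neg hc]; linarith
  -- (2) demand: regime_pointwise
  have hdem : ∀ ω ∈ E.powerset,
      (if 𝒱 ω ∧ b ∈ C (E \ ω) ∧ b ∉ C ω then
          (ha (C ω) - α₀ - max (hb (C (E \ ω)) - α₀) 0) * (ka (C ω) - γ₀ - max (kb (C (E \ ω)) - γ₀) 0) else 0)
        - (if 𝒱 ω ∧ b ∈ C (E \ ω) ∧ b ∉ C ω then α₀ * max (kb (C (E \ ω)) - γ₀) 0 else 0)
        - (if 𝒱 ω ∧ b ∈ C (E \ ω) ∧ b ∉ C ω then γ₀ * max (hb (C (E \ ω)) - α₀) 0 else 0)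
      ≤ (if 𝒱 ω ∧ b ∈ C (E \ ω) ∧ b ∉ C ω then (ha (C ω) - hb (C (E \ ω))) * (ka (C ω) - kb (C (E \ ω))) else 0) := by
    intro ω _
    by_cases hc : 𝒱 ω ∧ b ∈ C (E \ ω) ∧ b ∉ C ω
    · simp only [if_pos hc]
      have := regime_pointwise (α₀ := α₀) (γ₀ := γ₀) (a := ha (C ω)) (p := hb (C (E \ ω))) (c := ka (C ω)) (q := kb (C (E \ ω)))
        hα hγ (hαa ω) (hb0 _) (hγc ω) (kb0 _)
      linarith
    · simp only [if_neg hc]; linarith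
  -- (3) Harris: the (kᵇY − γ₀)⁺ mass on 𝒱 ∩ {b ∈ Y∖X} is at most the (k X − γ₀) mass on 𝒱 ∩ {b ∈ X∖Y}; same for h
  have harris : ∀ (lv lvb : Set V → ℝ) (θ : ℝ), Monotone lvb → (∀ X, lvb X ≤ lv X) → (∀ ω, θ ≤ lv (C ω)) →
      ∑ ω ∈ E.powerset, (if 𝒱 ω ∧ b ∈ C (E \ ω) ∧ b ∉ C ω then max (lvb (C (E \ ω)) - θ) 0 else 0)
        ≤ ∑ ω ∈ E.powerset, (if 𝒱 ω ∧ b ∈ C ω ∧ b ∉ C (E \ ω) then lv (C ω) - θ else 0) := by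
    intro lv lvb θ mlvb hle hθ
    set F : Finset ι → ℝ := fun ω => if 𝒱 ω then 1 else 0 with hF
    set Gf : Finset ι → ℝ := fun ω => if b ∈ C ω ∧ b ∉ C (E \ ω) then max (lvb (C ω) - θ) 0 else 0 with hGf
    have mF : Monotone F := by
      intro s t hst
      simp only [hF]
      by_cases hs : 𝒱 s
      · rw [if_pos hs, if_pos (hV hst hs)]
      · rw [if_neg hs]; by_cases ht : 𝒱 t
        · rw [if_pos ht]; exact zero_le_one
        · rw [if_neg ht]
    have mG : Monotone Gf := by
      intro s t hst
      simp only [hGf]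
      by_cases hs : b ∈ C s ∧ b ∉ C (E \ s)
      · have ht : b ∈ C t ∧ b ∉ C (E \ t) :=
          ⟨hCmono hst hs.1, fun hb' => hs.2 (hCmono (Finset.sdiff_subset_sdiff (le_refl E) hst) hb')⟩
        rw [if_pos hs, if_pos ht]
        exact max_le_max (sub_le_sub_right (mlvb (hCmono hst)) θ) (le_refl 0)
      · rw [if_neg hs]
        by_cases ht : b ∈ C t ∧ b ∉ C (E \ t)
        · rw [if_pos ht]; exact le_max_right _ _
        · rw [if_neg ht]
    have key := sum_mul_sdiff_le_sum_mul E F Gf mF mG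
    have lhs : ∑ ω ∈ E.powerset, F ω * Gf (E \ ω)
        = ∑ ω ∈ E.powerset, (if 𝒱 ω ∧ b ∈ C (E \ ω) ∧ b ∉ C ω then max (lvb (C (E \ ω)) - θ) 0 else 0) := by
      refine Finset.sum_congr rfl fun ω hω => ?_
      have hωE := Finset.mem_powerset.mp hω
      simp only [hF, hGf]
      rw [Finset.sdiff_sdiff_eq_self hωE]
      by_cases hv : 𝒱 ω
      · by_cases hc : b ∈ C (E \ ω) ∧ b ∉ C ω
        · rw [if_pos hv, if_pos hc, if_pos ⟨hv, hc⟩, one_mul]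
        · rw [if_pos hv, if_neg hc, if_neg (fun h' => hc h'.2), mul_zero]
      · rw [if_neg hv, zero_mul, if_neg (fun h' => hv h'.1)]
    have rhs : ∑ ω ∈ E.powerset, F ω * Gf ω
        ≤ ∑ ω ∈ E.powerset, (if 𝒱 ω ∧ b ∈ C ω ∧ b ∉ C (E \ ω) then lv (C ω) - θ else 0) := by
      refine Finset.sum_le_sum fun ω _ => ?_
      simp only [hF, hGf]
      by_cases hv : 𝒱 ω
      · by_cases hc : b ∈ C ω ∧ b ∉ C (E \ ω)
        · rw [if_pos hv, if_pos hc, if_pos ⟨hv, hc⟩, one_mul]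
          exact max_le (sub_le_sub_right (hle _) θ) (sub_nonneg.mpr (hθ ω))
        · rw [if_pos hv, if_neg hc, if_neg (fun h' => hc h'.2), mul_zero]
      · rw [if_neg hv, zero_mul, if_neg (fun h' => hv h'.1)]
    linarith
  have harrisK := harris k kb γ₀ mkb kbk hγk
  have harrisH := harris h hb α₀ mhb hbh hαh
  -- constants inside the sums
  have eK1 : ∑ ω ∈ E.powerset, (if 𝒱 ω ∧ b ∈ C (E \ ω) ∧ b ∉ C ω then α₀ * max (kb (C (E \ ω)) - γ₀) 0 else 0)
      = α₀ * ∑ ω ∈ E.powerset, (if 𝒱 ω ∧ b ∈ C (E \ ω) ∧ b ∉ C ω then max (kb (C (E \ ω)) - γ₀) 0 else 0) := by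
    rw [Finset.mul_sum]; refine Finset.sum_congr rfl fun ω _ => ?_; split_ifs <;> simp
  have eK2 : ∑ ω ∈ E.powerset, (if 𝒱 ω ∧ b ∈ C ω ∧ b ∉ C (E \ ω) then α₀ * (k (C ω) - γ₀) else 0)
      = α₀ * ∑ ω ∈ E.powerset, (if 𝒱 ω ∧ b ∈ C ω ∧ b ∉ C (E \ ω) then k (C ω) - γ₀ else 0) := by
    rw [Finset.mul_sum]; refine Finset.sum_congr rfl fun ω _ => ?_; split_ifs <;> simp
  have eH1 : ∑ ω ∈ E.powerset, (if 𝒱 ω ∧ b ∈ C (E \ ω) ∧ b ∉ C ω then γ₀ * max (hb (C (E \ ω)) - α₀) 0 else 0)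
      = γ₀ * ∑ ω ∈ E.powerset, (if 𝒱 ω ∧ b ∈ C (E \ ω) ∧ b ∉ C ω then max (hb (C (E \ ω)) - α₀) 0 else 0) := by
    rw [Finset.mul_sum]; refine Finset.sum_congr rfl fun ω _ => ?_; split_ifs <;> simp
  have eH2 : ∑ ω ∈ E.powerset, (if 𝒱 ω ∧ b ∈ C ω ∧ b ∉ C (E \ ω) then γ₀ * (h (C ω) - α₀) else 0)
      = γ₀ * ∑ ω ∈ E.powerset, (if 𝒱 ω ∧ b ∈ C ω ∧ b ∉ C (E \ ω) then h (C ω) - α₀ else 0) := by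
    rw [Finset.mul_sum]; refine Finset.sum_congr rfl fun ω _ => ?_; split_ifs <;> simp
  have tK := mul_le_mul_of_nonneg_left harrisK hα
  have tH := mul_le_mul_of_nonneg_left harrisH hγ
  have s1 := Finset.sum_le_sum hsup
  have s2 := Finset.sum_le_sum hdem
  rw [Finset.sum_add_distrib, Finset.sum_add_distrib] at s1
  rw [Finset.sum_sub_distrib, Finset.sum_sub_distrib] at s2
  rw [eK1, eH1] at s2
  rw [eK2, eH2] at s1
  linarith

open Classical in
/-- **CONJECTURE IET reduces to levels vanishing on `{u}`.**  If the increasing-event transfer inequality holds (for the given graph, `u`, `b`, `𝒱`) for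
every admissible level system with `hᵃ{u} = kᵃ{u} = 0`, it holds for every admissible level system. [cite: KozmaNitzan2024, Questions 8–9 (§5.5 p. 36) (context)] -/
theorem iet_of_iet_vanishing_base (ends : ι → Sym2 V) (E : Finset ι) (u b : V)
    (𝒱 : Finset ι → Prop) (hV : ∀ ⦃s t : Finset ι⦄, s ⊆ t → 𝒱 s → 𝒱 t)
    (H : ∀ (h k ha hb ka kb : Set V → ℝ),
      Monotone h → Monotone k → Monotone ha → Monotone hb → Monotone ka → Monotone kb →
      (∀ X, 0 ≤ ha X) → (∀ X, ha X ≤ h X) → (∀ X, 0 ≤ hb X) → (∀ X, hb X ≤ h X) →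
      (∀ X, 0 ≤ ka X) → (∀ X, ka X ≤ k X) → (∀ X, 0 ≤ kb X) → (∀ X, kb X ≤ k X) →
      ha {u} = 0 → ka {u} = 0 →
      0 ≤ (∑ ω ∈ E.powerset, if 𝒱 ω ∧ b ∈ openCluster (ends '' (↑ω : Set ι)) u ∧ b ∉ openCluster (ends '' (↑(E \ ω) : Set ι)) u then
          h (openCluster (ends '' (↑ω : Set ι)) u) * k (openCluster (ends '' (↑ω : Set ι)) u) else 0)
        + ∑ ω ∈ E.powerset, if 𝒱 ω ∧ b ∈ openCluster (ends '' (↑(E \ ω) : Set ι)) u ∧ b ∉ openCluster (ends '' (↑ω : Set ι)) u then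
          (ha (openCluster (ends '' (↑ω : Set ι)) u) - hb (openCluster (ends '' (↑(E \ ω) : Set ι)) u)) *
            (ka (openCluster (ends '' (↑ω : Set ι)) u) - kb (openCluster (ends '' (↑(E \ ω) : Set ι)) u)) else 0)
    (h k ha hb ka kb : Set V → ℝ)
    (hh : Monotone h) (hk : Monotone k) (mha : Monotone ha) (mhb : Monotone hb) (mka : Monotone ka) (mkb : Monotone kb)
    (ha0 : ∀ X, 0 ≤ ha X) (hah : ∀ X, ha X ≤ h X) (hb0 : ∀ X, 0 ≤ hb X) (hbh : ∀ X, hb X ≤ h X)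
    (ka0 : ∀ X, 0 ≤ ka X) (kak : ∀ X, ka X ≤ k X) (kb0 : ∀ X, 0 ≤ kb X) (kbk : ∀ X, kb X ≤ k X) :
    0 ≤ (∑ ω ∈ E.powerset, if 𝒱 ω ∧ b ∈ openCluster (ends '' (↑ω : Set ι)) u ∧ b ∉ openCluster (ends '' (↑(E \ ω) : Set ι)) u then
          h (openCluster (ends '' (↑ω : Set ι)) u) * k (openCluster (ends '' (↑ω : Set ι)) u) else 0)
        + ∑ ω ∈ E.powerset, if 𝒱 ω ∧ b ∈ openCluster (ends '' (↑(E \ ω) : Set ι)) u ∧ b ∉ openCluster (ends '' (↑ω : Set ι)) u then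
          (ha (openCluster (ends '' (↑ω : Set ι)) u) - hb (openCluster (ends '' (↑(E \ ω) : Set ι)) u)) *
            (ka (openCluster (ends '' (↑ω : Set ι)) u) - kb (openCluster (ends '' (↑(E \ ω) : Set ι)) u)) else 0 := by
  set α₀ : ℝ := ha {u} with hα₀
  set γ₀ : ℝ := ka {u} with hγ₀
  -- the reduced level system, written with `insert u` so that it is admissible on every set
  set h₂ : Set V → ℝ := fun S => h (insert u S) - α₀ with hh₂
  set ha₂ : Set V → ℝ := fun S => ha (insert u S) - α₀ with hha₂
  set hb₂ : Set V → ℝ := fun S => max (hb (insert u S) - α₀) 0 with hhb₂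
  set k₂ : Set V → ℝ := fun S => k (insert u S) - γ₀ with hk₂
  set ka₂ : Set V → ℝ := fun S => ka (insert u S) - γ₀ with hka₂
  set kb₂ : Set V → ℝ := fun S => max (kb (insert u S) - γ₀) 0 with hkb₂
  have mins : Monotone (fun S : Set V => insert u S) := fun S T hST => Set.insert_subset_insert hST
  have huin : ∀ S : Set V, ({u} : Set V) ⊆ insert u S := fun S => Set.singleton_subset_iff.mpr (Set.mem_insert u S)
  have haα : ∀ S, α₀ ≤ ha (insert u S) := fun S => mha (huin S)
  have kaγ : ∀ S, γ₀ ≤ ka (insert u S) := fun S => mka (huin S)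
  have red := H h₂ k₂ ha₂ hb₂ ka₂ kb₂
    (fun S T hST => sub_le_sub_right (hh (mins hST)) _) (fun S T hST => sub_le_sub_right (hk (mins hST)) _)
    (fun S T hST => sub_le_sub_right (mha (mins hST)) _) (fun S T hST => max_le_max (sub_le_sub_right (mhb (mins hST)) _) (le_refl 0))
    (fun S T hST => sub_le_sub_right (mka (mins hST)) _) (fun S T hST => max_le_max (sub_le_sub_right (mkb (mins hST)) _) (le_refl 0))
    (fun S => sub_nonneg.mpr (haα S)) (fun S => sub_le_sub_right (hah _) _)
    (fun S => le_max_right _ _) (fun S => max_le (sub_le_sub_right (hbh _) _) (sub_nonneg.mpr (le_trans (haα S) (hah _))))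
    (fun S => sub_nonneg.mpr (kaγ S)) (fun S => sub_le_sub_right (kak _) _)
    (fun S => le_max_right _ _) (fun S => max_le (sub_le_sub_right (kbk _) _) (sub_nonneg.mpr (le_trans (kaγ S) (kak _))))
    (by simp only [hha₂, Set.insert_eq_of_mem (Set.mem_singleton u), hα₀, sub_self])
    (by simp only [hka₂, Set.insert_eq_of_mem (Set.mem_singleton u), hγ₀, sub_self])
  have main := iet_regime_reduction ends E u b 𝒱 hV h k ha hb ka kb mha mhb mka mkb ha0 hah hb0 hbh ka0 kak kb0 kbk
  simp only [hh₂, hk₂, hha₂, hhb₂, hka₂, hkb₂] at red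
  exact le_trans red main

end Coefficientwise

end Summit.CriticalPhenomena.PercolationContinuityZ3.Theorems
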